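import Mathlib
import HarnessLib
import Summits.HubbardSuperconductivity.HubbardSuperconductivity.Theorems.KLProgrammeKLRegimeEngineTowerRemeasureSum

/-!
# Route `KLProgramme` — crux K3 ENGINE (stmt-HubbardSuperconductivity-20437 `KLRegimeEngineV17F2`), stub (b) v2, THE LEVELS PACKAGE (ℓ), instantiation (I2):
# THE LEVELLED SECOND-CONSERVATION-GAIN ROWS (`_abs`, `_abs34`) WITH AN m-UNIFORM CONSTANT («(I2)-CONST-UNIFORM»; needed by the `F = 1` track (H2) of
# «(I2)-KIT-HMU-LEV» for the two `F_0`-born summands; cell gate-hubbard-kl, seat p4 g17)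

The absolute counts are typed `∃ κ D ∀ m` with m-free thresholds, so the only per-degree quantity of the levelled `_abs`/`_abs34` rows (…RemeasureLevAbs,
…RemeasureLevAbs34, …RemeasureSum §3) is the outer `∃ C`, `C = (3CJ/2)^{m+1}·D^{m+1}·27^{m+1} = C₀^{m+1}`.  Same proofs with `m` moved inside:
`klLevNormOf_jump_le_klEng_abs_uniform`, `klLevNormOf_scaleZero_remeasure_le_klEng_abs_uniform`, `klLevNormOf_klTowerIncr_remeasure_le_klEng_abs_uniform`,
`klLevNormOf_jump_le_klEng_abs34_uniform`, `klLevNormOf_scaleZero_remeasure_le_klEng_abs34_uniform`, `klLevNormOf_klTowerIncr_remeasure_le_klEng_abs34_uniform`.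
Compositions of landed theorems; nothing about the model is asserted beyond them; nothing asserts (ℓ), any stub, K3 or superconductivity.
References: BGM 2006 §2.8 (2.76), (2.82)–(2.84) [cite: BenfattoGiulianiMastropietro2006].
-/

noncomputable section

namespace Summit.HubbardSuperconductivity.HubbardSuperconductivity.Theorems.EngineV8

set_option linter.dupNamespace false -- summit = problem name (single-conjunct summit), D-0017

open Classical
open Real Finset Literature.MathematicalPhysics.QuantumLattice Literature.Probability.LatticeModels GrassmannAlgebra
open Literature.MathematicalPhysics.QuantumLattice.FermiRG
open Summit.HubbardSuperconductivity.HubbardSuperconductivity.Theorems.KLRegimeSplit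
open Summit.HubbardSuperconductivity.HubbardSuperconductivity.Theorems.KLProgrammeLegKernels
open Summit.HubbardSuperconductivity.HubbardSuperconductivity.Theorems.DispersionFlow
open Summit.HubbardSuperconductivity.HubbardSuperconductivity.Theorems.KLRegimeWick
open Summit.HubbardSuperconductivity.HubbardSuperconductivity.Theorems.TorusFourierL2
open Summit.HubbardSuperconductivity.HubbardSuperconductivity.Theorems.PerturbedFermiCurve
open Literature.Probability.LatticeModels.BattleFederbush

variable {L M : ℕ} [NeZero L] [NeZero M]

omit [NeZero L] [NeZero M] in
/-- **m-UNIFORM twin of `klLevNormOf_jump_le_klEng_abs`**: the constant `C₀` (`= (3CJ/2)·27·D`) and the thresholds fixed before the degree; bound `C₀^{m+1}·(…)`.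
[cite: BenfattoGiulianiMastropietro2006, §2.8 (2.76), (2.82)-(2.84)] -/
theorem klLevNormOf_jump_le_klEng_abs_uniform :
    ∃ C₀ : ℝ, 0 < C₀ ∧ ∀ R : RenConsts, R.WF2 → ∃ c₃' : ℝ, 0 < c₃' ∧ ∃ U₀' : ℝ, 0 < U₀' ∧ ∀ m : ℕ,
      ∀ (P : SplitConsts) (c : ℝ), P.WF → 0 < c → c ≤ klEngC₃6 P R → c ≤ c₃' →
      ∀ μ ∈ klWindowC, ∀ U : ℝ, 0 < U → U ≤ klEngU₀9 P R c → U ≤ U₀' → ∀ β : ℝ, klBetaMin ≤ β → β ≤ Real.exp (c / U ^ 2) →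
      ∀ K : TrigPolyC4v, FrameOK R U (nScales β) μ K → ∀ (L M : ℕ) [NeZero L] [NeZero M],
      klEngL₃ β U ≤ L → klEngM₃ β U L ≤ M → ∀ k J' : ℕ, k + 1 ≤ J' → J' ≤ nScales β + 1 →
      ∀ T : HubbardGrassmann L M,
        (∀ (m' : ℕ) (X : Fin m' → HubbardFieldIdx L M), ∑ i, signedMomentum L (X i).2 (X i).1.1.2 ≠ 0 → kernel ℂ T m' X = 0) →
      ∀ (Ωe : Fin (m + 1) → Option (SectorLeg (sectorCount J'))), levelCount Ωe + 6 ≤ m + 1 → ∀ (N : ℝ), 0 ≤ N →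
        (∀ Ωe' : Fin (m + 1) → Option (SectorLeg (sectorCount k)), levelCount Ωe' = levelCount Ωe →
          klLevNormOf L M β μ K k (m + 1) T Ωe' ≤ N) →
        klLevNormOf L M β μ K J' (m + 1) T Ωe ≤ C₀ ^ (m + 1) * ((2 : ℝ) ^ J') ^ ((m + 1) - max (levelCount Ωe) 1 - 2) * N := by
  obtain ⟨CJ, hCJ, hov⟩ := overlap_jump_sums_klEng
  obtain ⟨D, hD, hreg⟩ := card_relCount_prescribed_absUmklapp_klAniso_le_window
  refine ⟨3 * CJ / 2 * (D * 27), by positivity, fun R hR2 => ?_⟩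
  have hRj : ∀ j, 0 ≤ R.Gfr j := gfr_nonneg_of_wf2 hR2
  obtain ⟨c₃, hc₃, U₀, hU₀, hcnt⟩ := hreg R hRj
  refine ⟨c₃, hc₃, U₀, hU₀, ?_⟩
  intro m P c hP hc hc6 hc₃' μ hμ U hU hU9 hU₀' β hβmin hβc K hK L M _ _ hL3 hM3 k J' hJ hJN T hT Ωe hlev N hN0 hN
  have hβ : 0 < β := KLRegimeSplit.pos_of_klBetaMin_le hβmin
  obtain ⟨_, hcol₁, hrow₁⟩ := hov P R c hP hR2 hc hc6 μ hμ U hU hU9 β hβmin hβc K hK L M hL3 hM3 k J' hJ hJN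
  have hc₁0 : (0 : ℝ) ≤ 3 * CJ * M / β := by positivity
  have h := klLevNormOf_jump_le_of_consts_abs hβ μ K hJ T hT hc₁0 hc₁0 hD.le hcol₁ hrow₁ m
    (fun E τ'' σ' hE => hcnt c hc hc₃' U hU hU₀' β hβmin hβc μ hμ μ K hK L M m k J' _ subset_rfl E τ'' σ' hE) Ωe hlev hN0 hN
  have hMne : (M : ℝ) ≠ 0 := by exact_mod_cast NeZero.ne M
  have hεc : imagTimeWeight β M * (3 * CJ * M / β) = 3 * CJ / 2 := by
    unfold imagTimeWeight; field_simp
  have hconst : (3 * CJ * M / β) ^ m * (3 * CJ * M / β) * imagTimeWeight β M ^ (m + 1) = (3 * CJ / 2) ^ (m + 1) := by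
    rw [← pow_succ, ← mul_pow, mul_comm (3 * CJ * M / β), hεc]
  calc klLevNormOf L M β μ K J' (m + 1) T Ωe
      ≤ (3 * CJ * M / β) ^ m * (3 * CJ * M / β) * imagTimeWeight β M ^ (m + 1) * (D ^ (m + 1) * 27 ^ (m + 1)) *
          ((2 : ℝ) ^ J') ^ ((m + 1) - max (levelCount Ωe) 1 - 2) * N := h
    _ = (3 * CJ / 2 * (D * 27)) ^ (m + 1) * ((2 : ℝ) ^ J') ^ ((m + 1) - max (levelCount Ωe) 1 - 2) * N := by rw [hconst, mul_pow, mul_pow]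

omit [NeZero L] [NeZero M] in
/-- **m-UNIFORM twin of `klLevNormOf_scaleZero_remeasure_le_klEng_abs`**: the constant `C₀` (`= (3CJ/2)·27·D`) and the thresholds fixed before the degree; bound `C₀^{m+1}·(…)`.
[cite: BenfattoGiulianiMastropietro2006, §2.8 (2.76), (2.82)-(2.84)] -/
theorem klLevNormOf_scaleZero_remeasure_le_klEng_abs_uniform :
    ∃ C₀ : ℝ, 0 < C₀ ∧ ∀ R : RenConsts, R.WF2 → ∃ c₃' : ℝ, 0 < c₃' ∧ ∃ U₀' : ℝ, 0 < U₀' ∧ ∀ m : ℕ,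
      ∀ (P : SplitConsts) (c : ℝ), P.WF → 0 < c → c ≤ klEngC₃6 P R → c ≤ c₃' →
      ∀ μ ∈ klWindowC, ∀ U : ℝ, 0 < U → U ≤ klEngU₀9 P R c → U ≤ U₀' → ∀ β : ℝ, klBetaMin ≤ β → β ≤ Real.exp (c / U ^ 2) →
      ∀ K : TrigPolyC4v, FrameOK R U (nScales β) μ K → ∀ (L M : ℕ) [NeZero L] [NeZero M],
      klEngL₃ β U ≤ L → klEngM₃ β U L ≤ M → ∀ J' : ℕ, 1 ≤ J' → J' ≤ nScales β + 1 →
      ∀ (Ωe : Fin (m + 1) → Option (SectorLeg (sectorCount J'))), levelCount Ωe + 6 ≤ m + 1 → ∀ (N₀ : ℝ), 0 ≤ N₀ →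
        (∀ Ωe' : Fin (m + 1) → Option (SectorLeg (sectorCount 0)), levelCount Ωe' = levelCount Ωe →
          klAnisoLegKernelNormAt L M β U μ K klE0 0 (m + 1) Ωe' ≤ N₀) →
        klLevNormOf L M β μ K J' (m + 1) (klEffectiveAction L M β U μ K klE0 0) Ωe ≤
          C₀ ^ (m + 1) * ((2 : ℝ) ^ J') ^ ((m + 1) - max (levelCount Ωe) 1 - 2) * N₀ := by
  obtain ⟨C, hC, h⟩ := klLevNormOf_jump_le_klEng_abs_uniform
  refine ⟨C, hC, fun R hR2 => ?_⟩
  obtain ⟨c₃, hc₃, U₀, hU₀, h'⟩ := h R hR2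
  refine ⟨c₃, hc₃, U₀, hU₀, ?_⟩
  intro m P c hP hc hc6 hc₃' μ hμ U hU hU9 hU₀' β hβmin hβc K hK L M _ _ hL3 hM3 J' hJ1 hJN Ωe hlev N₀ hN0 hN
  exact h' m P c hP hc hc6 hc₃' μ hμ U hU hU9 hU₀' β hβmin hβc K hK L M hL3 hM3 0 J' (by omega) hJN
    (klEffectiveAction L M β U μ K klE0 0) (klEffectiveAction_momentumConserving β U μ K klE0 0) Ωe hlev N₀ hN0
    (fun Ωe' hlev' => by rw [klLevNormOf_klEffectiveAction]; exact hN Ωe' hlev')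

omit [NeZero L] [NeZero M] in
/-- **m-UNIFORM twin of `klLevNormOf_klTowerIncr_remeasure_le_klEng_abs`**: the constant `C₀` (`= (3CJ/2)·27·D`) and the thresholds fixed before the degree; bound `C₀^{m+1}·(…)`.
[cite: BenfattoGiulianiMastropietro2006, §2.8 (2.76), (2.82)-(2.84)] -/
theorem klLevNormOf_klTowerIncr_remeasure_le_klEng_abs_uniform :
    ∃ C₀ : ℝ, 0 < C₀ ∧ ∀ R : RenConsts, R.WF2 → ∃ c₃' : ℝ, 0 < c₃' ∧ ∃ U₀' : ℝ, 0 < U₀' ∧ ∀ m : ℕ,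
      ∀ (P : SplitConsts) (c : ℝ), P.WF → 0 < c → c ≤ klEngC₃6 P R → c ≤ c₃' →
      ∀ μ ∈ klWindowC, ∀ U : ℝ, 0 < U → U ≤ klEngU₀9 P R c → U ≤ U₀' → ∀ β : ℝ, klBetaMin ≤ β → β ≤ Real.exp (c / U ^ 2) →
      ∀ K : TrigPolyC4v, FrameOK R U (nScales β) μ K → ∀ (L M : ℕ) [NeZero L] [NeZero M],
      klEngL₃ β U ≤ L → klEngM₃ β U L ≤ M → ∀ d k k' : ℕ, 2 ≤ d → k' < k → d * k - 1 ≤ nScales β + 1 →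
      ∀ Ωe : Fin (m + 1) → Option (SectorLeg (sectorCount (d * k - 1))), levelCount Ωe + 6 ≤ m + 1 →
        klLevNormOf L M β μ K (d * k - 1) (m + 1) (klTowerIncr L M β U μ K d k') Ωe ≤
          C₀ ^ (m + 1) * ((2 : ℝ) ^ (d * k - 1)) ^ ((m + 1) - max (levelCount Ωe) 1 - 2) * klTowerBornLev L M β U μ K d k' (m + 1) (levelCount Ωe) := by
  obtain ⟨C, hC, h⟩ := klLevNormOf_jump_le_klEng_abs_uniform
  refine ⟨C, hC, fun R hR2 => ?_⟩
  obtain ⟨c₃, hc₃, U₀, hU₀, h'⟩ := h R hR2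
  refine ⟨c₃, hc₃, U₀, hU₀, ?_⟩
  intro m P c hP hc hc6 hc₃' μ hμ U hU hU9 hU₀' β hβmin hβc K hK L M _ _ hL3 hM3 d k k' hd hk hkN Ωe hlev
  have hβ : 0 < β := KLRegimeSplit.pos_of_klBetaMin_le hβmin
  exact h' m P c hP hc hc6 hc₃' μ hμ U hU hU9 hU₀' β hβmin hβc K hK L M hL3 hM3 (d * k') (d * k - 1) (block_jump_le hd hk) hkN
    (klTowerIncr L M β U μ K d k') (fun m' X hX => klTowerIncr_momentumConserving β U μ K d k' m' X hX) Ωe hlev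
    (klTowerBornLev L M β U μ K d k' (m + 1) (levelCount Ωe)) (klTowerBornLev_nonneg hβ.le U μ K d k' (m + 1) _)
    (fun Ωe' hlev' => by rw [← hlev']; exact klLevNormOf_le_klTowerBornLev β U μ K d k' (m + 1) Ωe')

omit [NeZero L] [NeZero M] in
/-- **m-UNIFORM twin of `klLevNormOf_jump_le_klEng_abs34`**: the constant `C₀` (`= (3CJ/2)·27·D`) and the thresholds fixed before the degree; bound `C₀^{m+1}·(…)`.
[cite: BenfattoGiulianiMastropietro2006, §2.8 (2.76), (2.82)-(2.84)] -/
theorem klLevNormOf_jump_le_klEng_abs34_uniform :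
    ∃ C₀ : ℝ, 0 < C₀ ∧ ∀ R : RenConsts, R.WF2 → ∃ c₃' : ℝ, 0 < c₃' ∧ ∃ U₀' : ℝ, 0 < U₀' ∧ ∀ m : ℕ,
      ∀ (P : SplitConsts) (c : ℝ), P.WF → 0 < c → c ≤ klEngC₃6 P R → c ≤ c₃' →
      ∀ μ ∈ klWindowC, ∀ U : ℝ, 0 < U → U ≤ klEngU₀9 P R c → U ≤ U₀' → ∀ β : ℝ, klBetaMin ≤ β → β ≤ Real.exp (c / U ^ 2) →
      ∀ K : TrigPolyC4v, FrameOK R U (nScales β) μ K → ∀ (L M : ℕ) [NeZero L] [NeZero M],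
      klEngL₃ β U ≤ L → klEngM₃ β U L ≤ M → ∀ k J' : ℕ, k + 1 ≤ J' → J' ≤ nScales β + 1 →
      ∀ T : HubbardGrassmann L M,
        (∀ (m' : ℕ) (X : Fin m' → HubbardFieldIdx L M), ∑ i, signedMomentum L (X i).2 (X i).1.1.2 ≠ 0 → kernel ℂ T m' X = 0) →
      ∀ (Ωe : Fin (m + 1) → Option (SectorLeg (sectorCount J'))), levelCount Ωe + 4 ≤ m + 1 → ∀ (N : ℝ), 0 ≤ N →
        (∀ Ωe' : Fin (m + 1) → Option (SectorLeg (sectorCount k)), levelCount Ωe' = levelCount Ωe →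
          klLevNormOf L M β μ K k (m + 1) T Ωe' ≤ N) →
        klLevNormOf L M β μ K J' (m + 1) T Ωe ≤ C₀ ^ (m + 1) * ((J' : ℝ) + 1) * ((2 : ℝ) ^ J') ^ ((m + 1) - max (levelCount Ωe) 1 - 2) * N := by
  obtain ⟨CJ, hCJ, hov⟩ := overlap_jump_sums_klEng
  obtain ⟨D, hD, hreg⟩ := card_relCount34_prescribed_absUmklapp_klAniso_le_window
  refine ⟨3 * CJ / 2 * (D * 27), by positivity, fun R hR2 => ?_⟩
  have hRj : ∀ j, 0 ≤ R.Gfr j := gfr_nonneg_of_wf2 hR2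
  obtain ⟨c₃, hc₃, U₀, hU₀, hcnt⟩ := hreg R hRj
  refine ⟨c₃, hc₃, U₀, hU₀, ?_⟩
  intro m P c hP hc hc6 hc₃' μ hμ U hU hU9 hU₀' β hβmin hβc K hK L M _ _ hL3 hM3 k J' hJ hJN T hT Ωe hlev N hN0 hN
  have hβ : 0 < β := KLRegimeSplit.pos_of_klBetaMin_le hβmin
  obtain ⟨_, hcol₁, hrow₁⟩ := hov P R c hP hR2 hc hc6 μ hμ U hU hU9 β hβmin hβc K hK L M hL3 hM3 k J' hJ hJN
  have hc₁0 : (0 : ℝ) ≤ 3 * CJ * M / β := by positivity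
  have h := klLevNormOf_jump_le_of_consts_abs34 hβ μ K hJ T hT hc₁0 hc₁0 hD.le hcol₁ hrow₁ m
    (fun E τ'' σ' hE hEne => hcnt c hc hc₃' U hU hU₀' β hβmin hβc μ hμ μ K hK L M m k J' _ subset_rfl E τ'' σ' hE hEne) Ωe hlev hN0 hN
  have hMne : (M : ℝ) ≠ 0 := by exact_mod_cast NeZero.ne M
  have hεc : imagTimeWeight β M * (3 * CJ * M / β) = 3 * CJ / 2 := by
    unfold imagTimeWeight; field_simp
  have hconst : (3 * CJ * M / β) ^ m * (3 * CJ * M / β) * imagTimeWeight β M ^ (m + 1) = (3 * CJ / 2) ^ (m + 1) := by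
    rw [← pow_succ, ← mul_pow, mul_comm (3 * CJ * M / β), hεc]
  calc klLevNormOf L M β μ K J' (m + 1) T Ωe
      ≤ (3 * CJ * M / β) ^ m * (3 * CJ * M / β) * imagTimeWeight β M ^ (m + 1) * (D ^ (m + 1) * 27 ^ (m + 1)) * ((J' : ℝ) + 1) *
          ((2 : ℝ) ^ J') ^ ((m + 1) - max (levelCount Ωe) 1 - 2) * N := h
    _ = (3 * CJ / 2 * (D * 27)) ^ (m + 1) * ((J' : ℝ) + 1) * ((2 : ℝ) ^ J') ^ ((m + 1) - max (levelCount Ωe) 1 - 2) * N := by rw [hconst, mul_pow, mul_pow]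

omit [NeZero L] [NeZero M] in
/-- **m-UNIFORM twin of `klLevNormOf_scaleZero_remeasure_le_klEng_abs34`**: the constant `C₀` (`= (3CJ/2)·27·D`) and the thresholds fixed before the degree; bound `C₀^{m+1}·(…)`.
[cite: BenfattoGiulianiMastropietro2006, §2.8 (2.76), (2.82)-(2.84)] -/
theorem klLevNormOf_scaleZero_remeasure_le_klEng_abs34_uniform :
    ∃ C₀ : ℝ, 0 < C₀ ∧ ∀ R : RenConsts, R.WF2 → ∃ c₃' : ℝ, 0 < c₃' ∧ ∃ U₀' : ℝ, 0 < U₀' ∧ ∀ m : ℕ,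
      ∀ (P : SplitConsts) (c : ℝ), P.WF → 0 < c → c ≤ klEngC₃6 P R → c ≤ c₃' →
      ∀ μ ∈ klWindowC, ∀ U : ℝ, 0 < U → U ≤ klEngU₀9 P R c → U ≤ U₀' → ∀ β : ℝ, klBetaMin ≤ β → β ≤ Real.exp (c / U ^ 2) →
      ∀ K : TrigPolyC4v, FrameOK R U (nScales β) μ K → ∀ (L M : ℕ) [NeZero L] [NeZero M],
      klEngL₃ β U ≤ L → klEngM₃ β U L ≤ M → ∀ J' : ℕ, 1 ≤ J' → J' ≤ nScales β + 1 →
      ∀ (Ωe : Fin (m + 1) → Option (SectorLeg (sectorCount J'))), levelCount Ωe + 4 ≤ m + 1 → ∀ (N₀ : ℝ), 0 ≤ N₀ →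
        (∀ Ωe' : Fin (m + 1) → Option (SectorLeg (sectorCount 0)), levelCount Ωe' = levelCount Ωe →
          klAnisoLegKernelNormAt L M β U μ K klE0 0 (m + 1) Ωe' ≤ N₀) →
        klLevNormOf L M β μ K J' (m + 1) (klEffectiveAction L M β U μ K klE0 0) Ωe ≤
          C₀ ^ (m + 1) * ((J' : ℝ) + 1) * ((2 : ℝ) ^ J') ^ ((m + 1) - max (levelCount Ωe) 1 - 2) * N₀ := by
  obtain ⟨C, hC, h⟩ := klLevNormOf_jump_le_klEng_abs34_uniform
  refine ⟨C, hC, fun R hR2 => ?_⟩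
  obtain ⟨c₃, hc₃, U₀, hU₀, h'⟩ := h R hR2
  refine ⟨c₃, hc₃, U₀, hU₀, ?_⟩
  intro m P c hP hc hc6 hc₃' μ hμ U hU hU9 hU₀' β hβmin hβc K hK L M _ _ hL3 hM3 J' hJ1 hJN Ωe hlev N₀ hN0 hN
  exact h' m P c hP hc hc6 hc₃' μ hμ U hU hU9 hU₀' β hβmin hβc K hK L M hL3 hM3 0 J' (by omega) hJN
    (klEffectiveAction L M β U μ K klE0 0) (klEffectiveAction_momentumConserving β U μ K klE0 0) Ωe hlev N₀ hN0
    (fun Ωe' hlev' => by rw [klLevNormOf_klEffectiveAction]; exact hN Ωe' hlev')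

omit [NeZero L] [NeZero M] in
/-- **m-UNIFORM twin of `klLevNormOf_klTowerIncr_remeasure_le_klEng_abs34`**: the constant `C₀` (`= (3CJ/2)·27·D`) and the thresholds fixed before the degree; bound `C₀^{m+1}·(…)`.
[cite: BenfattoGiulianiMastropietro2006, §2.8 (2.76), (2.82)-(2.84)] -/
theorem klLevNormOf_klTowerIncr_remeasure_le_klEng_abs34_uniform :
    ∃ C₀ : ℝ, 0 < C₀ ∧ ∀ R : RenConsts, R.WF2 → ∃ c₃' : ℝ, 0 < c₃' ∧ ∃ U₀' : ℝ, 0 < U₀' ∧ ∀ m : ℕ,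
      ∀ (P : SplitConsts) (c : ℝ), P.WF → 0 < c → c ≤ klEngC₃6 P R → c ≤ c₃' →
      ∀ μ ∈ klWindowC, ∀ U : ℝ, 0 < U → U ≤ klEngU₀9 P R c → U ≤ U₀' → ∀ β : ℝ, klBetaMin ≤ β → β ≤ Real.exp (c / U ^ 2) →
      ∀ K : TrigPolyC4v, FrameOK R U (nScales β) μ K → ∀ (L M : ℕ) [NeZero L] [NeZero M],
      klEngL₃ β U ≤ L → klEngM₃ β U L ≤ M → ∀ d k k' : ℕ, 2 ≤ d → k' < k → d * k - 1 ≤ nScales β + 1 →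
      ∀ Ωe : Fin (m + 1) → Option (SectorLeg (sectorCount (d * k - 1))), levelCount Ωe + 4 ≤ m + 1 →
        klLevNormOf L M β μ K (d * k - 1) (m + 1) (klTowerIncr L M β U μ K d k') Ωe ≤
          C₀ ^ (m + 1) * (((d * k - 1 : ℕ) : ℝ) + 1) * ((2 : ℝ) ^ (d * k - 1)) ^ ((m + 1) - max (levelCount Ωe) 1 - 2) *
            klTowerBornLev L M β U μ K d k' (m + 1) (levelCount Ωe) := by
  obtain ⟨C, hC, h⟩ := klLevNormOf_jump_le_klEng_abs34_uniform
  refine ⟨C, hC, fun R hR2 => ?_⟩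
  obtain ⟨c₃, hc₃, U₀, hU₀, h'⟩ := h R hR2
  refine ⟨c₃, hc₃, U₀, hU₀, ?_⟩
  intro m P c hP hc hc6 hc₃' μ hμ U hU hU9 hU₀' β hβmin hβc K hK L M _ _ hL3 hM3 d k k' hd hk hkN Ωe hlev
  have hβ : 0 < β := KLRegimeSplit.pos_of_klBetaMin_le hβmin
  exact h' m P c hP hc hc6 hc₃' μ hμ U hU hU9 hU₀' β hβmin hβc K hK L M hL3 hM3 (d * k') (d * k - 1) (block_jump_le hd hk) hkN
    (klTowerIncr L M β U μ K d k') (fun m' X hX => klTowerIncr_momentumConserving β U μ K d k' m' X hX) Ωe hlev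
    (klTowerBornLev L M β U μ K d k' (m + 1) (levelCount Ωe)) (klTowerBornLev_nonneg hβ.le U μ K d k' (m + 1) _)
    (fun Ωe' hlev' => by rw [← hlev']; exact klLevNormOf_le_klTowerBornLev β U μ K d k' (m + 1) Ωe')

end Summit.HubbardSuperconductivity.HubbardSuperconductivity.Theorems.EngineV8

end
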